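import Summits.KontsevichZagierPeriods.KontsevichZagierPeriods.Theorems.VietaFibreKernelFormCut
import Summits.KontsevichZagierPeriods.KontsevichZagierPeriods.Theorems.VietaFibreKernelFormWeakKernelNormalForm
import HarnessLib

/-!
# Crux `KernelForm` (stmt-KontsevichZagierPeriods-10447), line `Sketch`: the cut in body language

The cut `KernelForm ↔ WeakKernel ∧ Cancellation` (`kernelForm_iff`) of the kernel form of
Kontsevich–Zagier's Conjecture 1 for the calculus of `KZCalculus.lean`, restated entirely in the
vocabulary of compact `ℚ`-semialgebraic BODIES (compact domains with non-empty interior, integrand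
`1`) and their products — the language of Hilbert's third problem and of Cresson–Viu-Sos' volume form
of the conjecture. Write `U` for the closed unit cube of the relevant dimension and `A ~ B` for
`[A] − [B] ∈ KZ.relations`.

* `exists_unitBody_sub_mem_relations` — KERNEL NORMAL FORM (unconditional): every formal combination
  of value `0` is `≡ [A] − [U]` with `A` a compact body of volume `1` of the same dimension as `U`
  (bounded decomposition, one merge with a far-away unit cube, Viu-Sos packing);
* `kernelForm_iff_unitBody` — `KernelForm ⟺` every compact unit-volume body is KZ-equivalent to the
  unit cube of its dimension ("cubing a unit-volume body"; sharpens the printed volume form, in which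
  both bodies vary);
* `weakKernel_iff_stablyCube` — `WeakKernel ⟺` every compact unit-volume body is STABLY cube-able:
  there is a compact body `K` with `K × A ~ K × U`;
* `cancellation_iff_bodyCancellation` — `Cancellation ⟺` body factors cancel:
  `K × A ~ K × U ⟹ A ~ U` (a Zylev-type cancellation, with an arbitrary compact body `K` as the
  stabiliser; stabilising by cubes is free, `[U'] * c ≡ c`);
* `kernelForm_iff_stablyCube_and_bodyCancellation` — the cut itself in this language:
  cube-able `⟺` stably cube-able `∧` body factors cancel; OctahedralSymmetry twin.

All statements are inline over the calculus (no definitions); the two halves stay conjecture-grade —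
these are normal forms, not discharges.

References: M. Kontsevich, D. Zagier, *Periods* (2001), §1.2, Problem 1; J. Cresson, J. Viu-Sos,
JTNB 34 (2022), §1 (volume form of the conjecture) and Problem 2.1; J. Viu-Sos, IJNT 17 (2021),
Thm. 1.1 and §4 (semi-canonical reduction, packing); V. B. Zylev, *Equicomposability of equicomplementable
polyhedra* (1965) (the cancellation pattern).
-/

noncomputable section

open MeasureTheory Set
open Literature.NumberTheory.Transcendental

namespace Summit.KontsevichZagierPeriods.KernelForm.LocaliseAtValuePrime

/-! ### Kernel normal form: `c ≡ [A] − [U]` -/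

/-- A unit-cube representation (domain `KZ.cube m`, integrand `1`) has value `1`. [folklore] -/
theorem value_eq_one_of_cube {m : ℕ} (U : KZ.IntegralRep m) (hUd : U.domain = KZ.cube m)
    (hUi : U.integrand = fun _ => 1) : U.value = 1 := by
  rw [KZ.IntegralRep.value_eq_volume_real U (fun x _ => by rw [hUi]), hUd, KZ.volume_real_cube]

/-- **Kernel normal form.** Every formal `ℤ`-combination `c` of integral representations with
`eval c = 0` is, modulo the moves, a difference `[A] − [U]` where `U` is the unit cube of some
dimension `k + 1` and `A` is a compact `ℚ`-semialgebraic body (non-empty interior, integrand `1`) of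
the same dimension and of volume `1`. Proof: `c ≡ [A₀] − [B₀]` (bounded volume forms,
`stub_boundedDecomposition`), `[A₀] + [U] ≡ [G]` (merge with a translate, `KZ.exists_merge₂`), and
`[G] − [B₀] ≡ [A]` with `A` compact of non-empty interior since `vol G − vol B₀ = eval c + 1 = 1 > 0`
(Viu-Sos packing, `KZ.exists_isCompact_of_sub_of_sub_mem_relations`). [cite: ViuSos2021, §4] [folklore] -/
theorem exists_unitBody_sub_mem_relations (c : KZ.FormalRep) (hc : KZ.eval c = 0) :
    ∃ (k : ℕ) (A U : KZ.IntegralRep (k + 1)), IsCompact A.domain ∧ (interior A.domain).Nonempty ∧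
      (∀ x ∈ A.domain, A.integrand x = 1) ∧ A.value = 1 ∧ U.domain = KZ.cube (k + 1) ∧
      (U.integrand = fun _ => 1) ∧ c - (KZ.of A - KZ.of U) ∈ KZ.relations := by
  -- (1) bounded decomposition `c ≡ [A₀] − [B₀]`
  obtain ⟨k, A₀, B₀, hA₀b, hB₀b, hA₀1, hB₀1, e⟩ := stub_boundedDecomposition c
  have hv : A₀.value = B₀.value := by
    have h := eval_eq_zero_of_mem e
    simp only [map_sub, KZ.eval_of, hc] at h
    linarith
  -- (2) the unit cube `U` and the merge `[A₀] + [U] ≡ [G]`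
  obtain ⟨U, hUd, hUi⟩ := KZ.exists_oneRep (KZ.isSemialgebraic_cube (n := k + 1))
    (by simp [KZ.volume_cube])
  have hUb : Bornology.IsBounded U.domain := hUd ▸ KZ.isCompact_cube.isBounded
  have hUv : U.value = 1 := value_eq_one_of_cube U hUd hUi
  obtain ⟨G, hGb, hG1, eG⟩ := KZ.exists_merge₂ A₀ U hA₀b hUb hA₀1 (fun x _ => by rw [hUi])
  have hGv : G.value = A₀.value + 1 := by
    have h := eval_eq_zero_of_mem eG
    simp only [map_sub, map_add, KZ.eval_of, hUv] at h
    linarith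
  -- (3) packing `[G] − [B₀] ≡ [A]`, `A` compact with non-empty interior, of volume `1`
  obtain ⟨A, hAc, hAi, hA1, eA⟩ :=
    KZ.exists_isCompact_of_sub_of_sub_mem_relations G B₀ hGb hB₀b hG1 hB₀1 (by linarith)
  have hAv : A.value = 1 := by
    have h := eval_eq_zero_of_mem eA
    simp only [map_sub, KZ.eval_of] at h
    linarith
  refine ⟨k, A, U, hAc, hAi, hA1, hAv, hUd, hUi, ?_⟩
  have : c - (KZ.of A - KZ.of U) =
      (c - (KZ.of A₀ - KZ.of B₀)) + (KZ.of A₀ + KZ.of U - KZ.of G) + (KZ.of G - KZ.of B₀ - KZ.of A) := by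
    abel
  rw [this]
  exact KZ.relations.add_mem (KZ.relations.add_mem e eG) eA

/-! ### `KernelForm`: cubing a unit-volume body -/

/-- **Conjecture 1 ⟺ cubing.** The kernel form of Conjecture 1 holds iff every compact
`ℚ`-semialgebraic body of volume `1` (non-empty interior, integrand `1`) is KZ-equivalent to the unit
cube of its dimension. (`→`: both have value `1`; `←`: the kernel normal form.) This sharpens the
printed volume form of the conjecture (two arbitrary compact bodies of equal volume) by fixing one
of the two bodies to be the cube. [cite: CressonViusos2022, §1 p. 326] [folklore] -/
theorem kernelForm_iff_unitBody :
    Summit.KontsevichZagierPeriods.KontsevichZagierPeriods.Theses.VietaFibre.KernelForm ↔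
      ∀ (k : ℕ) (A U : KZ.IntegralRep (k + 1)), IsCompact A.domain → (interior A.domain).Nonempty →
        (∀ x ∈ A.domain, A.integrand x = 1) → A.value = 1 → U.domain = KZ.cube (k + 1) →
        (U.integrand = fun _ => 1) → KZ.of A - KZ.of U ∈ KZ.relations := by
  unfold Summit.KontsevichZagierPeriods.KontsevichZagierPeriods.Theses.VietaFibre.KernelForm
  constructor
  · intro hK k A U _ _ _ hAv hUd hUi
    refine hK _ ?_
    rw [map_sub, KZ.eval_of, KZ.eval_of, hAv, value_eq_one_of_cube U hUd hUi, sub_self]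
  · intro h c hc
    obtain ⟨k, A, U, hAc, hAi, hA1, hAv, hUd, hUi, e⟩ := exists_unitBody_sub_mem_relations c hc
    have hAU := h k A U hAc hAi hA1 hAv hUd hUi
    have : c = (c - (KZ.of A - KZ.of U)) + (KZ.of A - KZ.of U) := by abel
    rw [this]
    exact KZ.relations.add_mem e hAU

/-! ### `WeakKernel`: stable cubing -/

/-- **Weak kernel ⟺ stable cubing.** Every formal combination of value `0` admits a canceller of
non-zero value iff every compact `ℚ`-semialgebraic body `A` of volume `1` is STABLY cube-able: there
is a compact body `K` (non-empty interior, integrand `1`, any dimension) with `K × A ~ K × U`, `U`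
the unit cube of the dimension of `A`. (`→`: apply the compact-canceller form of the weak kernel,
`weakKernel_iff_exists_compact`, to `[A] − [U]` and use `[K] * [A] = [K × A]`; `←`: kernel normal
form, then `[K]` (value `vol K > 0`) is a canceller, `relations` being a left ideal.) [folklore] -/
theorem weakKernel_iff_stablyCube :
    (∀ c : KZ.FormalRep, KZ.eval c = 0 → ∃ s : KZ.FormalRep, KZ.eval s ≠ 0 ∧ s * c ∈ KZ.relations) ↔
      ∀ (k : ℕ) (A U : KZ.IntegralRep (k + 1)), IsCompact A.domain → (interior A.domain).Nonempty →
        (∀ x ∈ A.domain, A.integrand x = 1) → A.value = 1 → U.domain = KZ.cube (k + 1) →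
        (U.integrand = fun _ => 1) →
        ∃ (m : ℕ) (K : KZ.IntegralRep (m + 1)), IsCompact K.domain ∧ (interior K.domain).Nonempty ∧
          (∀ x ∈ K.domain, K.integrand x = 1) ∧
          KZ.of (K.prod A) - KZ.of (K.prod U) ∈ KZ.relations := by
  rw [weakKernel_iff_exists_compact]
  constructor
  · intro hW k A U _ _ _ hAv hUd hUi
    have hc : KZ.eval (KZ.of A - KZ.of U) = 0 := by
      rw [map_sub, KZ.eval_of, KZ.eval_of, hAv, value_eq_one_of_cube U hUd hUi, sub_self]
    obtain ⟨m, K, hKc, hKi, hK1, hK⟩ := hW _ hc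
    refine ⟨m, K, hKc, hKi, hK1, ?_⟩
    rwa [mul_sub, KZ.of_mul_of, KZ.of_mul_of] at hK
  · intro h c hc
    obtain ⟨k, A, U, hAc, hAi, hA1, hAv, hUd, hUi, e⟩ := exists_unitBody_sub_mem_relations c hc
    obtain ⟨m, K, hKc, hKi, hK1, hK⟩ := h k A U hAc hAi hA1 hAv hUd hUi
    refine ⟨m, K, hKc, hKi, hK1, ?_⟩
    have : KZ.of K * c = KZ.of K * (c - (KZ.of A - KZ.of U)) + (KZ.of (K.prod A) - KZ.of (K.prod U)) := by
      rw [← KZ.of_mul_of, ← KZ.of_mul_of, mul_sub, mul_sub]; abel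
    rw [this]
    exact KZ.relations.add_mem (KZ.mul_mem_relations_left_holds _ _ e) hK

/-! ### `Cancellation`: body factors cancel -/

/-- **Cancellation ⟺ body factors cancel.** Multipliers of non-zero value are non-zero-divisors
modulo the moves iff for every compact `ℚ`-semialgebraic body `A` of volume `1`, the unit cube `U`
of its dimension and every compact body `K`: `K × A ~ K × U ⟹ A ~ U`. (`→`: `[K]` has value
`vol K > 0` and `[K] * ([A] − [U]) = [K × A] − [K × U]`; `←`: a canceller `s` of `c` forces
`eval c = 0`, so `c ≡ [A] − [U]` by the kernel normal form, and `s` may be replaced by a compact body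
`[K]` (`exists_compact_canceller_of_pos`, after a sign change), whence `K × A ~ K × U`.) The first
open instance is a stabiliser `K` of transcendental volume (algebraic cancellers cancel,
`cancellation_of_sub_scale_mem`). [folklore] -/
theorem cancellation_iff_bodyCancellation :
    (∀ c s : KZ.FormalRep, KZ.eval s ≠ 0 → s * c ∈ KZ.relations → c ∈ KZ.relations) ↔
      ∀ (k m : ℕ) (A U : KZ.IntegralRep (k + 1)) (K : KZ.IntegralRep (m + 1)), IsCompact A.domain →
        (interior A.domain).Nonempty → (∀ x ∈ A.domain, A.integrand x = 1) → A.value = 1 →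
        U.domain = KZ.cube (k + 1) → (U.integrand = fun _ => 1) →
        IsCompact K.domain → (interior K.domain).Nonempty → (∀ x ∈ K.domain, K.integrand x = 1) →
        KZ.of (K.prod A) - KZ.of (K.prod U) ∈ KZ.relations → KZ.of A - KZ.of U ∈ KZ.relations := by
  constructor
  · intro hC k m A U K _ _ _ _ _ _ hKc hKi hK1 hK
    refine hC _ (KZ.of K) (eval_of_pos_of_isCompact_of_interior_nonempty K hKc hKi hK1).ne' ?_
    rwa [mul_sub, KZ.of_mul_of, KZ.of_mul_of]
  · intro h c s hs hsc
    -- a canceller of non-zero value forces `eval c = 0`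
    have hc : KZ.eval c = 0 := by
      have h0 := eval_eq_zero_of_mem hsc
      rw [KZ.eval_mul'] at h0
      rcases mul_eq_zero.mp h0 with h0 | h0
      · exact absurd h0 hs
      · exact h0
    -- kernel normal form `c ≡ [A] − [U]`
    obtain ⟨k, A, U, hAc, hAi, hA1, hAv, hUd, hUi, e⟩ := exists_unitBody_sub_mem_relations c hc
    -- a compact body canceller `[K]`
    obtain ⟨m, K, hKc, hKi, hK1, hK⟩ :
        ∃ (m : ℕ) (K : KZ.IntegralRep (m + 1)), IsCompact K.domain ∧ (interior K.domain).Nonempty ∧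
          (∀ x ∈ K.domain, K.integrand x = 1) ∧ KZ.of K * c ∈ KZ.relations := by
      rcases lt_or_gt_of_ne hs with hneg | hpos
      · refine exists_compact_canceller_of_pos c (-s) ?_ ?_
        · rw [map_neg]; linarith
        · rw [neg_mul]; exact KZ.relations.neg_mem hsc
      · exact exists_compact_canceller_of_pos c s hpos hsc
    -- `K × A ~ K × U`, hence `A ~ U`, hence `c ≡ 0`
    have hKAU : KZ.of (K.prod A) - KZ.of (K.prod U) ∈ KZ.relations := by
      have : KZ.of (K.prod A) - KZ.of (K.prod U) =
          KZ.of K * c - KZ.of K * (c - (KZ.of A - KZ.of U)) := by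
        rw [← KZ.of_mul_of, ← KZ.of_mul_of, mul_sub, mul_sub]; abel
      rw [this]
      exact KZ.relations.sub_mem hK (KZ.mul_mem_relations_left_holds _ _ e)
    have hAU := h k m A U K hAc hAi hA1 hAv hUd hUi hKc hKi hK1 hKAU
    have : c = (c - (KZ.of A - KZ.of U)) + (KZ.of A - KZ.of U) := by abel
    rw [this]
    exact KZ.relations.add_mem e hAU

/-! ### The cut in body language -/

/-- **The cut in body language.** The kernel form of Conjecture 1 ("every compact unit-volume body
is cube-able", `kernelForm_iff_unitBody`) is equivalent to the conjunction of STABLE CUBING (the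
transcendence half `WeakKernel`) and CANCELLATION OF BODY FACTORS (the geometric half
`Cancellation`, ≡ SelbergAMGM.PositiveCancellation stmt-5621 ≡ ¬ Neg.CancellationGap stmt-11011).
[folklore] -/
theorem kernelForm_iff_stablyCube_and_bodyCancellation :
    Summit.KontsevichZagierPeriods.KontsevichZagierPeriods.Theses.VietaFibre.KernelForm ↔
      (∀ (k : ℕ) (A U : KZ.IntegralRep (k + 1)), IsCompact A.domain → (interior A.domain).Nonempty →
        (∀ x ∈ A.domain, A.integrand x = 1) → A.value = 1 → U.domain = KZ.cube (k + 1) →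
        (U.integrand = fun _ => 1) →
        ∃ (m : ℕ) (K : KZ.IntegralRep (m + 1)), IsCompact K.domain ∧ (interior K.domain).Nonempty ∧
          (∀ x ∈ K.domain, K.integrand x = 1) ∧
          KZ.of (K.prod A) - KZ.of (K.prod U) ∈ KZ.relations) ∧
      (∀ (k m : ℕ) (A U : KZ.IntegralRep (k + 1)) (K : KZ.IntegralRep (m + 1)), IsCompact A.domain →
        (interior A.domain).Nonempty → (∀ x ∈ A.domain, A.integrand x = 1) → A.value = 1 →
        U.domain = KZ.cube (k + 1) → (U.integrand = fun _ => 1) →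
        IsCompact K.domain → (interior K.domain).Nonempty → (∀ x ∈ K.domain, K.integrand x = 1) →
        KZ.of (K.prod A) - KZ.of (K.prod U) ∈ KZ.relations → KZ.of A - KZ.of U ∈ KZ.relations) := by
  rw [kernelForm_iff, weakKernel_iff_stablyCube, cancellation_iff_bodyCancellation]

/-- **OctahedralSymmetry twin** of `kernelForm_iff_unitBody` (route OctahedralSymmetry's name of the
crux is the same term). [folklore] -/
theorem octahedralSymmetry_kernelForm_iff_unitBody :
    Summit.KontsevichZagierPeriods.KontsevichZagierPeriods.Theses.OctahedralSymmetry.KernelForm ↔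
      ∀ (k : ℕ) (A U : KZ.IntegralRep (k + 1)), IsCompact A.domain → (interior A.domain).Nonempty →
        (∀ x ∈ A.domain, A.integrand x = 1) → A.value = 1 → U.domain = KZ.cube (k + 1) →
        (U.integrand = fun _ => 1) → KZ.of A - KZ.of U ∈ KZ.relations :=
  octahedralSymmetry_kernelForm_iff_vietaFibre_kernelForm.trans kernelForm_iff_unitBody

/-- **OctahedralSymmetry twin** of the cut in body language. [folklore] -/
theorem octahedralSymmetry_kernelForm_iff_stablyCube_and_bodyCancellation :
    Summit.KontsevichZagierPeriods.KontsevichZagierPeriods.Theses.OctahedralSymmetry.KernelForm ↔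
      (∀ (k : ℕ) (A U : KZ.IntegralRep (k + 1)), IsCompact A.domain → (interior A.domain).Nonempty →
        (∀ x ∈ A.domain, A.integrand x = 1) → A.value = 1 → U.domain = KZ.cube (k + 1) →
        (U.integrand = fun _ => 1) →
        ∃ (m : ℕ) (K : KZ.IntegralRep (m + 1)), IsCompact K.domain ∧ (interior K.domain).Nonempty ∧
          (∀ x ∈ K.domain, K.integrand x = 1) ∧
          KZ.of (K.prod A) - KZ.of (K.prod U) ∈ KZ.relations) ∧
      (∀ (k m : ℕ) (A U : KZ.IntegralRep (k + 1)) (K : KZ.IntegralRep (m + 1)), IsCompact A.domain →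
        (interior A.domain).Nonempty → (∀ x ∈ A.domain, A.integrand x = 1) → A.value = 1 →
        U.domain = KZ.cube (k + 1) → (U.integrand = fun _ => 1) →
        IsCompact K.domain → (interior K.domain).Nonempty → (∀ x ∈ K.domain, K.integrand x = 1) →
        KZ.of (K.prod A) - KZ.of (K.prod U) ∈ KZ.relations → KZ.of A - KZ.of U ∈ KZ.relations) :=
  octahedralSymmetry_kernelForm_iff_vietaFibre_kernelForm.trans
    kernelForm_iff_stablyCube_and_bodyCancellation

end Summit.KontsevichZagierPeriods.KernelForm.LocaliseAtValuePrime
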